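import Literature.NumberTheory.EllipticCurves.Kato2004.IwasawaH2Descent
import Literature.NumberTheory.EllipticCurves.Kato2004.IntegralH1FiniteProofs
import HarnessLib

/-!
# Kato 2004 (Astérisque 295) §14.14 (14.14.1): the `𝐇²_Γ`-descent package `IwasawaH2Data` is
# inhabited as soon as `proj₀` is injective modulo `T` and `H¹(ℤ[1/p], T_pW)` is finitely generated —
# and, given (12.2.1) for `𝐇¹_Γ`, these two statements are exactly its content

Topic `NumberTheory/EllipticCurves`, sub-directory `Kato2004` (namespace = path). Cell `bsd-cn100`,
prover seat `bsd-cn100-transfer-2` (g8). `Proofs`-style file: theorems only (no definition, no named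
fact, no `sorry`, no instance). Bears on the conjunct `Kato2004.nonempty_iwasawaH2Data` of
`stub_refereedInputs` of the registered lines `kato-zeta-perrin-riou` (stmt-BirchSwinnertonDyer-19080 /
-19160), on `Kato2004.exists_memberHullInputs` (cell `bsd-potss`, item 19659/19196, whose fields
`H2/A/ι/π` are those of `IwasawaH2Data` verbatim) and on the S3 Kato–zeta road of cell `bsd-2adic`.

## What is proved

The hypothesis structure `IwasawaH2Data W p κ γ I` (file `IwasawaH2Descent`) pins `A = H¹(ℤ[1/p], T_pW)`
to the tree's `integralH1 (tateRep W p) p (κ.layerSubgroup 0)` and `ι` to `proj₀`, but leaves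
`H2 = 𝐇²_Γ(T_pW)` ABSTRACT (only `H2[T] = coker ι` is pinned).  Its module docstring says so honestly:
"witnesses for the abstract field could be manufactured from consequences plus the pinned data".
This file carries that remark out in the kernel and identifies the consequences EXACTLY:

* `IwasawaH1Data.proj_zero_smul` — `proj₀ (g • x) = g(0) • proj₀ x`: `Λ` acts on the bottom layer
  through the augmentation (from the pin: `proj_C_smul`, `proj_T_smul`, `γ ∈ Γ_ℚ`).
* **`nonempty_iwasawaH2Data_of_proj_zero_injective_of_finite`** — for ONE pin `I`: if
  (α) `∀ x, I.proj 0 x = 0 → x ∈ T·𝐇¹_Γ` (the injectivity half of Kato's (14.14.1), i.e. exactness of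
  the `Λ`-adic long exact sequence at `𝐇¹`) and (β) `H¹(ℤ[1/p], T_pW)` is a finitely generated
  `ℤ_p`-module (Kato (12.2.1) at level `0` / [NSW (8.3.20) (i)] / [Rubin, ES, Prop. B.2.7]), then
  `IwasawaH2Data W p κ γ I` is inhabited — by `A := H¹(ℤ[1/p], T_pW)` with `Λ` acting through
  `g ↦ g(0)`, `ι :=` the map induced by `proj₀`, `H2 := A ⧸ ι(𝐇¹_Γ/T)` (on which `T` acts as `0`, so
  `H2[T] = H2`, `H2` is `Λ`-torsion because `X ∈ Λ` is a non-zero-divisor, and finitely generated by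
  (β)), `π :=` the quotient map.
* **`nonempty_iwasawaH2Data_of_forall`** — the named-fact shape: (α) for every pin ∧ (β) for every
  `(W, p, κ)` ⟹ `Kato2004.nonempty_iwasawaH2Data`.
* **`IwasawaH2Data.module_finite_integralH1`** — conversely, a package together with (12.2.1) for
  `𝐇¹_Γ` (`Module.Finite Λ I.H`, the first conjunct of `Kato2004.thm12_4`) GIVES (β); and (α) on a
  package is the tree theorem `IwasawaH2Data.proj_zero_eq_zero_iff_mem_TSubmodule`.  So, modulo
  (12.2.1) for `𝐇¹_Γ`, the named fact `nonempty_iwasawaH2Data` is EQUIVALENT to (α) ∧ (β): it carries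
  no information about Kato's `𝐇²_Γ(T_pW)` beyond "`proj₀` is injective mod `T`" and "weak
  Mordell–Weil for `T_pW` over `ℤ[1/p]`" (`nonempty_iwasawaH2Data_iff_of_finite`).

* **APPENDED 2026-08-27 (after (β) LANDED as the tree theorem
  `Kato2004.module_finite_integralH1_layerZero`, file `IntegralH1FiniteProofs`, seat `bsd-cn100-s2-c3`
  g10, p494565):** `nonempty_iwasawaH2Data_of_proj_zero_injective` — the package ⟸ (α) ALONE;
  `nonempty_iwasawaH2Data_iff_proj_zero_injective` — for every pin, `IwasawaH2Data W p κ γ I` is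
  inhabited IFF (α), unconditionally; `nonempty_iwasawaH2Data_of_forall_isTopGenerator` — the
  named-fact shape with (α) asked only under the fact's own binders `κ.IsCyclotomic`,
  `κ.IsTopGenerator γ` (for `γ` NOT a topological generator (α) is false — e.g. `γ = 1` makes `T`
  act as `0` — so this, not `nonempty_iwasawaH2Data_of_forall`, is the form a proof of Kato's
  (14.14.1) injectivity will discharge; remark of seat `bsd-cn100-transfer` g12).  NET: the RI
  conjunct `Kato2004.nonempty_iwasawaH2Data` modulo tree theorems = (α) alone.

HONEST FRAMING.  Nothing here proves (α); (α) is the Shapiro / `Λ`-adic long-exact-sequence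
statement recorded as open by cell `bsd-potss` (FINDING-19196-rkm-g7) and claimed by seat
`bsd-cn100-transfer` g12; (β) is the tree theorem of the companion file `IntegralH1FiniteProofs`.  No statement about `𝐇²_Γ` itself, Kato's main conjecture,
the cruxes of `CongruentShaFreeCut` / `MordellShaFreeCut`, or BSD is advanced.  The theorems are a
CALIBRATION of a named fact (what a consumer of `nonempty_iwasawaH2Data` actually receives).

## References

* K. Kato, *p-adic Hodge theory and values of zeta functions of modular forms*, Astérisque 295
  (2004): §13.8 (p. 228), §14.14 (14.14.1) (p. 243), §12.2 (12.2.1) (p. 220). [Kato2004Asterisque]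
* J. Neukirch, A. Schmidt, K. Wingberg, *Cohomology of Number Fields*, 2nd ed. (2008), (8.3.20).
  [NeukirchSchmidtWingberg2008]
* K. Rubin, *Euler Systems* (2000), App. B Prop. B.2.7. [Rubin2000]
* Tree: `Kato2004/IwasawaH2Descent.lean` (the package), `Kato2004/IwasawaCohomologyLevelZero.lean`
  (`projZero`, `proj_zero_X_smul`), `IwasawaEulerCharProofs.lean` (`invariants`, `TSubmodule`).
-/

noncomputable section

open Field
open Literature.NumberTheory.GaloisRepresentations
open Literature.NumberTheory.EllipticCurves Literature.NumberTheory.EllipticCurves.Kato2004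
open Literature.NumberTheory.EllipticCurves.Kato2004.EulerSystemValues
open Literature.NumberTheory.EllipticCurves.IwasawaAlgebra

namespace Literature.NumberTheory.EllipticCurves.Kato2004

variable {W : WeierstrassCurve ℚ} [W.IsElliptic] {p : ℕ} [Fact p.Prime]
  [ContinuousSMul ℤ_[p] (W.tateModule p)] {κ : ZpExtension ℚ p} {γ : absoluteGaloisGroup ℚ}

/-! ## `Λ` acts on the bottom layer through the augmentation -/

/-- **`proj₀ (g • x) = g(0) • proj₀ x`**: on the bottom layer `H¹(ℚ, T_pW)` the Iwasawa algebra acts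
through the augmentation `g ↦ g(0)` (`T = conj_γ − 1` acts as `0` since `γ ∈ Γ_ℚ = κ.layerSubgroup 0`,
tree `IwasawaH1Data.proj_zero_X_smul`; constants act through `ℤ_p`, `proj_C_smul`).  This is why the
`Λ`-structure of `A = H¹(ℤ[1/p], T_pW)` in (14.14.1) is the augmentation structure.
[cite: Kato2004Asterisque, §14.14 (14.14.1) (p. 243)] -/
theorem IwasawaH1Data.proj_zero_smul (I : IwasawaH1Data W p κ γ) (g : IwasawaAlgebra p) (x : I.H) :
    I.proj 0 (g • x) = PowerSeries.constantCoeff g • I.proj 0 x := by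
  have hg : g = PowerSeries.C (PowerSeries.constantCoeff g) +
      PowerSeries.X * PowerSeries.mk fun n => PowerSeries.coeff (n + 1) g := by
    rw [← PowerSeries.sub_const_eq_X_mul_shift, add_sub_cancel]
  conv_lhs => rw [hg]
  rw [add_smul, map_add, I.proj_C_smul, mul_smul, I.proj_zero_X_smul, add_zero]

/-! ## The manufacture: a package from (α) and (β) -/

/-- **Kato's descent package from (14.14.1)-injectivity and weak Mordell–Weil.**  For a pinned
Iwasawa cohomology `I : IwasawaH1Data W p κ γ`: if
(α) `proj₀ x = 0 ⟹ x ∈ T·𝐇¹_Γ` for every `x ∈ 𝐇¹_Γ(T_pW)` (injectivity of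
`𝐇¹_Γ/T𝐇¹_Γ → H¹(ℤ[1/p], T_pW)`, Kato (14.14.1)), and
(β) `H¹(ℤ[1/p], T_pW) = integralH1 (tateRep W p) p (κ.layerSubgroup 0)` is a finitely generated
`ℤ_p`-module ((12.2.1) at level `0`),
then `IwasawaH2Data W p κ γ I` is inhabited.  Witness: `A := H¹(ℤ[1/p], T_pW)` with `g • a := g(0) • a`,
`ι := proj₀`, `H2 := A ⧸ ι(𝐇¹_Γ/T𝐇¹_Γ)` (killed by `T`, hence `= H2[T]`, `Λ`-torsion, finitely
generated), `π :=` the quotient map — the manufacture announced in the docstring of `IwasawaH2Descent`.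
[cite: Kato2004Asterisque, §14.14 (14.14.1) (p. 243) and §13.8 (p. 228)] -/
theorem nonempty_iwasawaH2Data_of_proj_zero_injective_of_finite (I : IwasawaH1Data W p κ γ)
    (hα : ∀ x : I.H, I.proj 0 x = 0 → x ∈ TSubmodule p I.H)
    (hβ : Module.Finite ℤ_[p] ↥(integralH1 (tateRep W p) p (κ.layerSubgroup 0))) :
    Nonempty (IwasawaH2Data W p κ γ I) := by
  classical
  -- `A := H¹(ℤ[1/p], T_pW)` with `Λ` acting through the augmentation `g ↦ g(0)`
  let A : Type := ↥(integralH1 (tateRep W p) p (κ.layerSubgroup 0))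
  letI instΛ : Module (IwasawaAlgebra p) A :=
    Module.compHom A (PowerSeries.constantCoeff (R := ℤ_[p]))
  have hsmul : ∀ (g : IwasawaAlgebra p) (a : A), g • a = PowerSeries.constantCoeff g • a :=
    fun _ _ => rfl
  haveI : IsScalarTower ℤ_[p] (IwasawaAlgebra p) A := ⟨fun c g a => by
    rw [hsmul, hsmul, smul_smul, PowerSeries.smul_eq_C_mul, map_mul, PowerSeries.constantCoeff_C]⟩
  haveI : Module.Finite ℤ_[p] A := hβ
  haveI hAfin : Module.Finite (IwasawaAlgebra p) A :=
    Module.Finite.of_restrictScalars_finite ℤ_[p] (IwasawaAlgebra p) A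
  have hXA : ∀ a : A, (PowerSeries.X : IwasawaAlgebra p) • a = 0 := fun a => by
    rw [hsmul, PowerSeries.constantCoeff_X, zero_smul]
  -- `ι : 𝐇¹_Γ/T𝐇¹_Γ → A` induced by `proj₀`
  let φ : I.H →ₗ[IwasawaAlgebra p] A :=
    { toFun := fun x => ⟨I.proj 0 x, I.proj_mem 0 x⟩
      map_add' := fun x y => Subtype.ext (map_add (I.proj 0) x y)
      map_smul' := fun g x => Subtype.ext (by
        rw [RingHom.id_apply, hsmul, Submodule.coe_smul]
        exact I.proj_zero_smul g x) }
  have hφ : TSubmodule p I.H ≤ LinearMap.ker φ := fun x hx =>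
    LinearMap.mem_ker.mpr (Subtype.ext (I.proj_zero_eq_zero_of_mem_TSubmodule hx))
  let ι : coinvariants p I.H →ₗ[IwasawaAlgebra p] A := (TSubmodule p I.H).liftQ φ hφ
  have hι_mk : ∀ x : I.H, (ι (Submodule.Quotient.mk x) : H1 (tateRep W p) (κ.layerSubgroup 0)) =
      I.proj 0 x := fun _ => rfl
  -- `H2 := A ⧸ ι(𝐇¹_Γ/T𝐇¹_Γ)`, killed by `T`
  let H2 : Type := A ⧸ LinearMap.range ι
  have hXH2 : ∀ m : H2, (PowerSeries.X : IwasawaAlgebra p) • m = 0 := fun m => by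
    obtain ⟨a, rfl⟩ := Submodule.Quotient.mk_surjective (LinearMap.range ι) m
    rw [← Submodule.Quotient.mk_smul, hXA, Submodule.Quotient.mk_zero]
  let π : A →ₗ[IwasawaAlgebra p] invariants p H2 :=
    LinearMap.codRestrict (invariants p H2) (LinearMap.range ι).mkQ fun a =>
      (mem_invariants_iff p H2 _).mpr (hXH2 _)
  refine ⟨{
    H2 := H2
    A := A
    finite_H2 := inferInstance
    isTorsion_H2 := fun m =>
      ⟨⟨PowerSeries.X, mem_nonZeroDivisors_of_ne_zero PowerSeries.X_ne_zero⟩, hXH2 m⟩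
    toH1 := (integralH1 (tateRep W p) p (κ.layerSubgroup 0)).subtype.toAddMonoidHom
    toH1_injective := Subtype.val_injective
    mem_range_toH1_iff := fun x =>
      ⟨fun ⟨a, ha⟩ => ha ▸ a.2, fun hx => ⟨⟨x, hx⟩, rfl⟩⟩
    toH1_smul := fun g a => rfl
    ι := ι
    π := π
    ι_injective := ?_
    π_surjective := ?_
    exact_ι_π := ?_
    toH1_ι := fun x => hι_mk x }⟩
  · -- (α): `ι` injective
    rw [← LinearMap.ker_eq_bot, LinearMap.ker_eq_bot']
    intro q hq
    obtain ⟨x, rfl⟩ := Submodule.Quotient.mk_surjective (TSubmodule p I.H) q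
    have h0 : I.proj 0 x = 0 := by
      rw [← hι_mk x, hq]; rfl
    exact (Submodule.Quotient.mk_eq_zero _).mpr (hα x h0)
  · -- `π` surjective
    intro y
    obtain ⟨a, ha⟩ := Submodule.Quotient.mk_surjective (LinearMap.range ι) (y : H2)
    exact ⟨a, Subtype.ext ha⟩
  · -- exactness in the middle
    intro a
    rw [Set.mem_range]
    constructor
    · intro ha
      have ha' : (LinearMap.range ι).mkQ a = 0 := congrArg Subtype.val ha
      rw [Submodule.mkQ_apply, Submodule.Quotient.mk_eq_zero, LinearMap.mem_range] at ha'
      exact ha'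
    · rintro ⟨q, rfl⟩
      apply Subtype.ext
      change (LinearMap.range ι).mkQ (ι q) = 0
      rw [Submodule.mkQ_apply, Submodule.Quotient.mk_eq_zero]
      exact LinearMap.mem_range_self ι q

/-- **The named-fact shape.**  If (α) holds for every pin and (β) for every `(W, p, κ)`, then Kato's
descent package exists in the sense of the named fact `Kato2004.nonempty_iwasawaH2Data` (for every
elliptic `W/ℚ`, prime `p`, cyclotomic `κ`, topological generator `γ`, pin `I`).  The cyclotomic /
generator hypotheses of the fact are not even used. [cite: Kato2004Asterisque, §14.14 (14.14.1) (p. 243)] -/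
theorem nonempty_iwasawaH2Data_of_forall
    (hα : ∀ (W : WeierstrassCurve ℚ) [W.IsElliptic] (p : ℕ) [Fact p.Prime]
      [ContinuousSMul ℤ_[p] (W.tateModule p)] (κ : ZpExtension ℚ p) (γ : absoluteGaloisGroup ℚ)
      (I : IwasawaH1Data W p κ γ) (x : I.H), I.proj 0 x = 0 → x ∈ TSubmodule p I.H)
    (hβ : ∀ (W : WeierstrassCurve ℚ) [W.IsElliptic] (p : ℕ) [Fact p.Prime]
      [ContinuousSMul ℤ_[p] (W.tateModule p)] (κ : ZpExtension ℚ p),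
      Module.Finite ℤ_[p] ↥(integralH1 (tateRep W p) p (κ.layerSubgroup 0))) :
    nonempty_iwasawaH2Data := by
  intro W _ p _ _ κ γ _ _ I
  exact nonempty_iwasawaH2Data_of_proj_zero_injective_of_finite I (hα W p κ γ I) (hβ W p κ)

/-! ## The converse: a package with (12.2.1) for `𝐇¹_Γ` gives (β) -/

namespace IwasawaH2Data

variable {I : IwasawaH1Data W p κ γ} (J : IwasawaH2Data W p κ γ I)

/-- On a package, `A = H¹(ℤ[1/p], T_pW)` is a finitely generated `Λ`-module as soon as `𝐇¹_Γ` is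
((12.2.1)): `A/ι(𝐇¹_Γ/T) ≅ H2[T] ⊆ H2` is finitely generated (`Λ` noetherian, `H2` finitely
generated) and `ι(𝐇¹_Γ/T)` is a quotient of `𝐇¹_Γ`. [cite: Kato2004Asterisque, §12.2 (12.2.1) (p. 220) and §14.14 (14.14.1) (p. 243)] -/
theorem module_finite_A (hH : Module.Finite (IwasawaAlgebra p) I.H) :
    Module.Finite (IwasawaAlgebra p) J.A := by
  haveI := hH
  haveI : Module.Finite (IwasawaAlgebra p) J.H2 := J.finite_H2
  haveI : IsNoetherian (IwasawaAlgebra p) J.H2 := isNoetherian_of_isNoetherianRing_of_finite _ _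
  -- `H2[T]` finitely generated, hence `A ⧸ range ι`
  have hinv : (invariants p J.H2).FG := IsNoetherian.noetherian _
  haveI : Module.Finite (IwasawaAlgebra p) ↥(invariants p J.H2) := Module.Finite.iff_fg.mpr hinv
  haveI hq : Module.Finite (IwasawaAlgebra p) (J.A ⧸ LinearMap.range J.ι) :=
    Module.Finite.equiv J.invariantsEquivCoker.symm
  -- `range ι` finitely generated (image of the coinvariants of the finitely generated `𝐇¹_Γ`)
  have hrange : (LinearMap.range J.ι).FG := by
    rw [LinearMap.range_eq_map]
    exact Submodule.FG.map _ Module.Finite.fg_top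
  refine Module.finite_def.mpr
    (Submodule.fg_of_fg_map_of_fg_inf_ker (s := ⊤) (LinearMap.range J.ι).mkQ ?_ ?_)
  · rw [Submodule.map_top, Submodule.range_mkQ]
    exact Module.Finite.fg_top
  · rw [Submodule.ker_mkQ, top_inf_eq]
    exact hrange

/-- **(β) from a package and (12.2.1) for `𝐇¹_Γ`.**  If `IwasawaH2Data W p κ γ I` is inhabited and
`𝐇¹_Γ(T_pW)` is a finitely generated `Λ`-module, then `H¹(ℤ[1/p], T_pW) = integralH1 (tateRep W p) p
(κ.layerSubgroup 0)` is a finitely generated `ℤ_p`-module: `A` is finitely generated over `Λ`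
(`module_finite_A`), `Λ` acts on `A` through `g ↦ g(0)` (`toH1_smul`), and `toH1 : A ≅ H¹(ℤ[1/p], T_pW)`.
[cite: Kato2004Asterisque, §12.2 (12.2.1) (p. 220) and §14.14 (14.14.1) (p. 243)] -/
theorem module_finite_integralH1 (J : IwasawaH2Data W p κ γ I)
    (hH : Module.Finite (IwasawaAlgebra p) I.H) :
    Module.Finite ℤ_[p] ↥(integralH1 (tateRep W p) p (κ.layerSubgroup 0)) := by
  classical
  haveI := J.module_finite_A hH
  obtain ⟨s, hs⟩ := Module.Finite.fg_top (R := IwasawaAlgebra p) (M := J.A)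
  -- the additive bijection `A → integralH1`
  let e : J.A → ↥(integralH1 (tateRep W p) p (κ.layerSubgroup 0)) := fun a => ⟨J.toH1 a, J.toH1_mem a⟩
  refine Module.finite_def.mpr ⟨s.image e, ?_⟩
  refine le_antisymm le_top ?_
  rintro ⟨x, hx⟩ -
  obtain ⟨a, ha⟩ := J.exists_eq_toH1_of_mem hx
  have hxe : (⟨x, hx⟩ : ↥(integralH1 (tateRep W p) p (κ.layerSubgroup 0))) = e a := Subtype.ext ha.symm
  rw [hxe]
  have ha_mem : a ∈ Submodule.span (IwasawaAlgebra p) (s : Set J.A) := by rw [hs]; exact Submodule.mem_top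
  -- induction on the `Λ`-span: `e` is additive and `e (g • a) = g(0) • e a`
  refine Submodule.span_induction (p := fun a _ => e a ∈ Submodule.span ℤ_[p]
      ((s.image e : Finset _) : Set ↥(integralH1 (tateRep W p) p (κ.layerSubgroup 0))))
    (fun a ha => Submodule.subset_span (Finset.mem_coe.mpr (Finset.mem_image_of_mem e ha)))
    ?_ ?_ ?_ ha_mem
  · have : e 0 = 0 := Subtype.ext (map_zero J.toH1)
    rw [this]; exact Submodule.zero_mem _
  · intro a b _ _ ha hb
    have : e (a + b) = e a + e b := Subtype.ext (map_add J.toH1 a b)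
    rw [this]; exact Submodule.add_mem _ ha hb
  · intro g a _ ha
    have : e (g • a) = PowerSeries.constantCoeff g • e a := Subtype.ext (J.toH1_smul g a)
    rw [this]; exact Submodule.smul_mem _ _ ha

end IwasawaH2Data

/-- **Calibration of the named fact.**  For a pin `I` with `𝐇¹_Γ(T_pW)` finitely generated over `Λ`
((12.2.1), first conjunct of `Kato2004.thm12_4`): `IwasawaH2Data W p κ γ I` is inhabited **iff**
(α) `proj₀ x = 0 ⟹ x ∈ T·𝐇¹_Γ` for all `x` AND (β) `H¹(ℤ[1/p], T_pW)` is a finitely generated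
`ℤ_p`-module.  (`→`: `proj_zero_eq_zero_iff_mem_TSubmodule` and `module_finite_integralH1`;
`←`: the manufacture.)  This is what a consumer of `nonempty_iwasawaH2Data` receives — no more.
[cite: Kato2004Asterisque, §14.14 (14.14.1) (p. 243) and §12.2 (12.2.1) (p. 220)] -/
theorem nonempty_iwasawaH2Data_iff_of_finite (I : IwasawaH1Data W p κ γ)
    (hH : Module.Finite (IwasawaAlgebra p) I.H) :
    Nonempty (IwasawaH2Data W p κ γ I) ↔
      (∀ x : I.H, I.proj 0 x = 0 → x ∈ TSubmodule p I.H) ∧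
        Module.Finite ℤ_[p] ↥(integralH1 (tateRep W p) p (κ.layerSubgroup 0)) := by
  constructor
  · rintro ⟨J⟩
    exact ⟨fun x hx => (J.proj_zero_eq_zero_iff_mem_TSubmodule x).mp hx, J.module_finite_integralH1 hH⟩
  · rintro ⟨hα, hβ⟩
    exact nonempty_iwasawaH2Data_of_proj_zero_injective_of_finite I hα hβ

/-! ## Appended: with (β) a tree theorem, the package ⟸ (α) alone -/

/-- **Kato's descent package from (14.14.1)-injectivity ALONE.**  For every elliptic `W/ℚ`, prime
`p`, `ℤ_p`-extension datum `κ`, `γ`, and pin `I : IwasawaH1Data W p κ γ`: if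
`proj₀ x = 0 ⟹ x ∈ T·𝐇¹_Γ` for all `x ∈ 𝐇¹_Γ(T_pW)`, then `IwasawaH2Data W p κ γ I` is inhabited —
hypothesis (β) of `nonempty_iwasawaH2Data_of_proj_zero_injective_of_finite` being the tree theorem
`module_finite_integralH1_layerZero` (weak Mordell–Weil for `T_pW`, file `IntegralH1FiniteProofs`).
[cite: Kato2004Asterisque, §14.14 (14.14.1) (p. 243)] -/
theorem nonempty_iwasawaH2Data_of_proj_zero_injective (I : IwasawaH1Data W p κ γ)
    (hα : ∀ x : I.H, I.proj 0 x = 0 → x ∈ TSubmodule p I.H) :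
    Nonempty (IwasawaH2Data W p κ γ I) :=
  nonempty_iwasawaH2Data_of_proj_zero_injective_of_finite I hα
    (module_finite_integralH1_layerZero W p κ)

/-- **Calibration, final form: the package is inhabited IFF `proj₀` is injective modulo `T`.**  For
every pin `I`, `Nonempty (IwasawaH2Data W p κ γ I) ↔ ∀ x, I.proj 0 x = 0 → x ∈ T·𝐇¹_Γ` — no
finiteness hypothesis left (`→` is `IwasawaH2Data.proj_zero_eq_zero_iff_mem_TSubmodule`).  So the
named fact `nonempty_iwasawaH2Data` says EXACTLY: Kato's (14.14.1) is left exact on the pinned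
`𝐇¹_Γ(T_pW)`. [cite: Kato2004Asterisque, §14.14 (14.14.1) (p. 243)] -/
theorem nonempty_iwasawaH2Data_iff_proj_zero_injective (I : IwasawaH1Data W p κ γ) :
    Nonempty (IwasawaH2Data W p κ γ I) ↔ ∀ x : I.H, I.proj 0 x = 0 → x ∈ TSubmodule p I.H :=
  ⟨fun ⟨J⟩ x hx => (J.proj_zero_eq_zero_iff_mem_TSubmodule x).mp hx,
    nonempty_iwasawaH2Data_of_proj_zero_injective I⟩

/-- **The named-fact shape to be discharged.**  If (α) holds for every pin UNDER THE FACT'S OWN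
BINDERS (`κ` cyclotomic, `γ` a topological generator — without a generator hypothesis (α) is false),
then `Kato2004.nonempty_iwasawaH2Data` holds.  This is the door through which a proof of Kato's
(14.14.1) injectivity (the `Λ`-adic long exact sequence at `𝐇¹`) turns the RI conjunct into a tree
theorem. [cite: Kato2004Asterisque, §14.14 (14.14.1) (p. 243)] -/
theorem nonempty_iwasawaH2Data_of_forall_isTopGenerator
    (hα : ∀ (W : WeierstrassCurve ℚ) [W.IsElliptic] (p : ℕ) [Fact p.Prime]
      [ContinuousSMul ℤ_[p] (W.tateModule p)] (κ : ZpExtension ℚ p) (γ : absoluteGaloisGroup ℚ),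
      κ.IsCyclotomic → κ.IsTopGenerator γ → ∀ (I : IwasawaH1Data W p κ γ) (x : I.H),
        I.proj 0 x = 0 → x ∈ TSubmodule p I.H) :
    nonempty_iwasawaH2Data := by
  intro W _ p _ _ κ γ hκ hγ I
  exact nonempty_iwasawaH2Data_of_proj_zero_injective I (hα W p κ γ hκ hγ I)

end Literature.NumberTheory.EllipticCurves.Kato2004

end
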